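import Mathlib
import Summits.ValiantsHypothesis.ValiantsHypothesis.Theorems.DissociatedFixedK.Negative.LoadBearing

/-!
# Crux `DissociatedFixedK` (stmt-ValiantsHypothesis-5907), line `annihilator-product-functional` —
stub `stub_exposedWord`: blueprint steps 1–2 (dictionary + strict exposure)

Setting of the crux: `k` products of `m` bivariate polynomials `f i j : MvPolynomial (Fin 2) ℂ` on a
dissociated frame, i.e. `supp (f i j) ⊆ A j` and the sum map `a ↦ Σ_j a_j` injective on `Π_j A_j`.

* **Step 1 (dictionary).**  On such a frame the coefficient of `X^{Σ_j a_j}` in `Σ_i Π_j f_ij` is the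
  tensor value `T(a) = Σ_i Π_j coeff_{a_j} f_ij` (`coeff_sum_prod_of_dissociated`), and every exponent
  in the support of `Σ_i Π_j f_ij` is `Σ_j a_j` for a frame word `a ∈ Π_j A_j` with `T(a) ≠ 0`
  (`exists_word_of_mem_support`).
* **Step 2 (exposure).**  An extreme point of the convex hull of a FINITE set in a real normed space
  is strictly exposed by a continuous linear functional
  (`exists_strict_sep_of_mem_extremePoints_convexHull`, Hahn–Banach against the compact hull of the
  other points).

Together (`stub_exposedWord`): every vertex `p` of the Newton polygon of `Σ_i Π_j f_ij` is
`emb (Σ_j a_j)` for a frame word `a` with `T(a) ≠ 0` which is the STRICT maximiser, among all other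
frame words `a'` with `T(a') ≠ 0`, of some continuous linear functional `l` on `ℝ²`
(`emb e = fun i => ((e i : ℕ) : ℝ)`, the crux's literal embedding, injective:
`Negative.LoadBearing.emb_injective`).  [folklore; KPTT arXiv:1308.2286 §2 for the setting]
-/

namespace Summit.ValiantsHypothesis.Theorems.DissociatedFixedK

open scoped BigOperators Classical
open Finset
open Summit.ValiantsHypothesis.ValiantsHypothesis.Theorems.DissociatedFixedK.Negative (emb emb_injective)

noncomputable section

-- adapted from Cruxes/DissociatedFixedK/FullProof-annihilator-product-functional.lean §E0, §E1, §S
-- (= the standing disprover's Disproof.lean v3 prover kit)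

/-! ## §E0  Blueprint step 2: extreme points of a finite set are strictly exposed -/

/-- **Blueprint step 2 (exposure), prover-facing.**  An extreme point of the convex hull of a FINITE
set in a normed space (used: `Fin 2 → ℝ`) is strictly exposed by a continuous linear functional:
`l y < l x` for every other point `y` of the set.  (Hahn–Banach against the compact convex hull of the
other points.) [folklore] -/
theorem exists_strict_sep_of_mem_extremePoints_convexHull {E : Type*} [NormedAddCommGroup E]
    [NormedSpace ℝ E] {S : Set E} (hS : S.Finite) {x : E}
    (hx : x ∈ Set.extremePoints ℝ (convexHull ℝ S)) :
    ∃ l : E →L[ℝ] ℝ, ∀ y ∈ S, y ≠ x → l y < l x := by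
  set S' : Set E := S \ {x} with hS'
  have hS'fin : S'.Finite := hS.subset Set.sdiff_subset
  have hK : IsCompact (convexHull ℝ S') := Set.Finite.isCompact_convexHull (𝕜 := ℝ) hS'fin
  have hxK : x ∉ convexHull ℝ S' := by
    intro hmem
    have h := ((convex_convexHull ℝ S).mem_extremePoints_iff_mem_sdiff_convexHull_sdiff).mp hx
    apply h.2
    refine convexHull_mono ?_ hmem
    intro y hy
    exact ⟨subset_convexHull ℝ S hy.1, hy.2⟩
  obtain ⟨f, u, hfx, hfb⟩ :=
    geometric_hahn_banach_point_closed (convex_convexHull ℝ S') hK.isClosed hxK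
  refine ⟨-f, ?_⟩
  intro y hy hne
  have : u < f y := hfb y (subset_convexHull ℝ S' ⟨hy, hne⟩)
  show -f y < -f x
  linarith

/-! ## §E1  Blueprint step 1: in the dissociated regime the coefficient IS the rank-`k` tensor -/

section Coeff

open MvPolynomial

variable {R : Type*} [CommSemiring R] {σ : Type*}

/-- A polynomial whose support lies in `A` is the sum of its terms over `A`. [folklore] -/
theorem eq_sum_monomial_of_support_subset (p : MvPolynomial σ R) (A : Finset (σ →₀ ℕ))
    (h : p.support ⊆ A) : p = ∑ e ∈ A, monomial e (coeff e p) := by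
  conv_lhs => rw [p.as_sum]
  apply Finset.sum_subset h
  intro e _ he
  rw [notMem_support_iff.mp he, monomial_zero]

/-- Expansion of a product of polynomials with supports in the letter sets `A j`:
`Π_j f_j = Σ_{g ∈ Π_j A_j} (Π_j coeff (g j) f_j) · X^{Σ_j g j}`. [folklore] -/
theorem prod_eq_sum_piFinset {m : ℕ} (A : Fin m → Finset (σ →₀ ℕ)) (f : Fin m → MvPolynomial σ R)
    (hsupp : ∀ j, (f j).support ⊆ A j) :
    (∏ j, f j) = ∑ g ∈ Fintype.piFinset A, monomial (∑ j, g j) (∏ j, coeff (g j) (f j)) := by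
  have : (∏ j, f j) = ∏ j, ∑ e ∈ A j, monomial e (coeff e (f j)) :=
    Finset.prod_congr rfl (fun j _ => eq_sum_monomial_of_support_subset (f j) (A j) (hsupp j))
  rw [this, Finset.prod_univ_sum]
  apply Finset.sum_congr rfl
  intro g _
  rw [monomial_sum_prod]

/-- **Coefficient formula (blueprint step 1).**  With `supp f_ij ⊆ A_j` and the sum map injective on
`Π_j A_j`, the coefficient of `X^{Σ_j a_j}` in `Σ_i Π_j f_ij` is the tensor value
`T(a) = Σ_i Π_j coeff (a j) (f i j)`. [folklore] -/
theorem coeff_sum_prod_of_dissociated {k m : ℕ} (A : Fin m → Finset (σ →₀ ℕ))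
    (f : Fin k → Fin m → MvPolynomial σ R) (hsupp : ∀ i j, (f i j).support ⊆ A j)
    (hinj : ∀ a b : Fin m → (σ →₀ ℕ), (∀ j, a j ∈ A j) → (∀ j, b j ∈ A j) →
      ∑ j, a j = ∑ j, b j → a = b)
    (a : Fin m → (σ →₀ ℕ)) (ha : ∀ j, a j ∈ A j) :
    coeff (∑ j, a j) (∑ i, ∏ j, f i j) = ∑ i, ∏ j, coeff (a j) (f i j) := by
  classical
  rw [coeff_sum]
  apply Finset.sum_congr rfl
  intro i _
  rw [prod_eq_sum_piFinset A (f i) (hsupp i), coeff_sum]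
  have hamem : a ∈ Fintype.piFinset A := Fintype.mem_piFinset.mpr ha
  rw [Finset.sum_eq_single_of_mem a hamem]
  · simp
  · intro g hg hga
    rw [coeff_monomial, if_neg]
    intro hsum
    exact hga (hinj g a (Fintype.mem_piFinset.mp hg) ha hsum)

/-- **Support formula (blueprint step 1).**  Every exponent in the support of `Σ_i Π_j f_ij` is
`Σ_j a_j` for a grid word `a ∈ Π_j A_j` with `T(a) ≠ 0`. [folklore] -/
theorem exists_word_of_mem_support {k m : ℕ} (A : Fin m → Finset (σ →₀ ℕ))
    (f : Fin k → Fin m → MvPolynomial σ R) (hsupp : ∀ i j, (f i j).support ⊆ A j)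
    (hinj : ∀ a b : Fin m → (σ →₀ ℕ), (∀ j, a j ∈ A j) → (∀ j, b j ∈ A j) →
      ∑ j, a j = ∑ j, b j → a = b)
    {e : σ →₀ ℕ} (he : e ∈ (∑ i, ∏ j, f i j).support) :
    ∃ a : Fin m → (σ →₀ ℕ), (∀ j, a j ∈ A j) ∧ ∑ j, a j = e ∧
      ∑ i, ∏ j, coeff (a j) (f i j) ≠ 0 := by
  classical
  -- the support of the sum of products lies in the image of the grid
  have hsub : (∑ i, ∏ j, f i j).support ⊆
      (Fintype.piFinset A).image (fun g => ∑ j, g j) := by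
    refine (MvPolynomial.support_sum).trans ?_
    intro e' he'
    simp only [Finset.mem_biUnion, Finset.mem_univ, true_and] at he'
    obtain ⟨i, hi⟩ := he'
    rw [prod_eq_sum_piFinset A (f i) (hsupp i)] at hi
    have := MvPolynomial.support_sum hi
    simp only [Finset.mem_biUnion] at this
    obtain ⟨g, hg, hge⟩ := this
    have := support_monomial_subset hge
    simp only [Finset.mem_singleton] at this
    exact Finset.mem_image.mpr ⟨g, hg, this.symm⟩
  obtain ⟨a, ha, rfl⟩ := Finset.mem_image.mp (hsub he)
  refine ⟨a, Fintype.mem_piFinset.mp ha, rfl, ?_⟩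
  rw [← coeff_sum_prod_of_dissociated A f hsupp hinj a (Fintype.mem_piFinset.mp ha)]
  exact mem_support_iff.mp he

end Coeff

/-! ## §S  The registered stub, closed with the kit -/

/-- **`stub_exposedWord`** (crux `DissociatedFixedK`, line `annihilator-product-functional`) —
blueprint steps 1–2 (dictionary + strict exposure).  Every vertex `p` of the Newton polygon of
`Σ_i Π_j f_ij` on a dissociated frame (`supp f_ij ⊆ A_j`, sum map injective on `Π_j A_j`) is
`emb (Σ_j a_j)` for a frame word `a` with nonzero tensor value `T(a) = Σ_i Π_j coeff_{a_j} f_ij`, which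
is the STRICT maximiser, among all other frame words with nonzero tensor value, of some continuous
linear functional `l` on `ℝ²`.  [Hahn–Banach against the hull of the other (finitely many) support
points = `exists_strict_sep_of_mem_extremePoints_convexHull`; coefficient/support formula =
`coeff_sum_prod_of_dissociated`, `exists_word_of_mem_support`; `emb` is injective.] [folklore] -/
theorem stub_exposedWord {k m : ℕ} (A : Fin m → Finset (Fin 2 →₀ ℕ))
    (f : Fin k → Fin m → MvPolynomial (Fin 2) ℂ)
    (hf : ∀ i j, (f i j).support ⊆ A j)
    (hinj : ∀ a b : Fin m → (Fin 2 →₀ ℕ), (∀ j, a j ∈ A j) → (∀ j, b j ∈ A j) →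
      ∑ j, a j = ∑ j, b j → a = b)
    (p : Fin 2 → ℝ)
    (hp : p ∈ Set.extremePoints ℝ (convexHull ℝ
      ((fun e : Fin 2 →₀ ℕ => fun i : Fin 2 => ((e i : ℕ) : ℝ)) ''
        ((∑ i, ∏ j, f i j).support : Set (Fin 2 →₀ ℕ))))) :
    ∃ (a : Fin m → (Fin 2 →₀ ℕ)) (l : (Fin 2 → ℝ) →L[ℝ] ℝ),
      (∀ j, a j ∈ A j) ∧
      p = (fun i : Fin 2 => (((∑ j, a j) i : ℕ) : ℝ)) ∧
      (∑ i, ∏ j, (f i j).coeff (a j)) ≠ 0 ∧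
      ∀ a' : Fin m → (Fin 2 →₀ ℕ), (∀ j, a' j ∈ A j) → a' ≠ a →
        (∑ i, ∏ j, (f i j).coeff (a' j)) ≠ 0 →
        l (fun i : Fin 2 => (((∑ j, a' j) i : ℕ) : ℝ)) < l (fun i : Fin 2 => (((∑ j, a j) i : ℕ) : ℝ)) := by
  classical
  have hpS : p ∈ (fun e : Fin 2 →₀ ℕ => fun i : Fin 2 => ((e i : ℕ) : ℝ)) ''
      ((∑ i, ∏ j, f i j).support : Set (Fin 2 →₀ ℕ)) :=
    extremePoints_convexHull_subset hp
  obtain ⟨e, he, rfl⟩ := hpS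
  obtain ⟨a, ha, hae, hTa⟩ := exists_word_of_mem_support A f hf hinj (Finset.mem_coe.1 he)
  have hfin : ((fun e : Fin 2 →₀ ℕ => fun i : Fin 2 => ((e i : ℕ) : ℝ)) ''
      ((∑ i, ∏ j, f i j).support : Set (Fin 2 →₀ ℕ))).Finite :=
    (Finset.finite_toSet _).image _
  obtain ⟨l, hl⟩ := exists_strict_sep_of_mem_extremePoints_convexHull hfin hp
  refine ⟨a, l, ha, ?_, hTa, ?_⟩
  · rw [hae]
  · intro a' ha' hne hTa'
    have hmem : (∑ j, a' j) ∈ (∑ i, ∏ j, f i j).support := by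
      rw [MvPolynomial.mem_support_iff, coeff_sum_prod_of_dissociated A f hf hinj a' ha']
      exact hTa'
    have hneq : (fun i : Fin 2 => (((∑ j, a' j) i : ℕ) : ℝ)) ≠ (fun i : Fin 2 => ((e i : ℕ) : ℝ)) := by
      intro heq
      apply hne
      apply hinj a' a ha' ha
      rw [hae]
      exact emb_injective heq
    have hlt := hl _ ⟨_, Finset.mem_coe.2 hmem, rfl⟩ hneq
    rw [hae]
    exact hlt

end

end Summit.ValiantsHypothesis.Theorems.DissociatedFixedK
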